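import Literature.Computability.AlgebraicComplexity.GroupTheoreticMatMul
import Mathlib.Analysis.Convex.SpecificFunctions.Basic

/-!
# `RectangularThmB` (crux stmt-MatrixMultiplication-10597, route ThinBlockAlpha):
# the B-difference translate bound `(L+1)·N² ≤ |H|` — no finite witness against the crux

Negative-side support file of the crux disprover (cdisprove seat); `sorry`-free, imports only the
tree's `IsSTPP` (Cohn–Kleinberg–Szegedy–Umans Def. 5.1, additive form).

* `succ_mul_sq_le_card` — in an STPP family with blocks `⟨N, M, N⟩`, `M ≥ 2`, `L ≥ 1`, in a finite
  abelian group: `(L + 1) · N² ≤ |H|`.  The sets `S_i = A_i − C_i` have `N²` elements and are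
  pairwise disjoint (the two-leg packing bound `L N² ≤ |H|`), and the translate of one of them by a
  nonzero `B`-difference misses all of them (IsSTPP instance `(i,i,k)`).  So exact two-leg
  tightness `|H| = L N²` is impossible once `M ≥ 2`.
* `no_finite_witness` — consequently every single thin family (`N, M ≥ 2`) admits some `η > 0`
  with `L · N^{2+η} < |H|`: the crux `RectangularThmB` cannot be refuted by a finite witness, only
  by a sequence with `log(|H|/(L N²))/log N → 0`.
-/

namespace Summit.MatrixMultiplication.MatrixMultiplication.Theorems.RectangularThmB.Negative

open Literature.Computability.AlgebraicComplexity

/-- **The first two-leg invariant** (refuter g40-63's remark on the item, kernel-checked): in an STPP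
family with blocks `⟨N, M, N⟩`, `M ≥ 2`, `L ≥ 1`, the sets `S_i = A_i − C_i` (each of size `N²`,
pairwise disjoint: the two-leg packing bound `L N² ≤ |H|`) leave room for one more translate
`S_{i₀} + (t' − t)`, `t ≠ t' ∈ B_{i₀}`, which misses EVERY `S_k` (IsSTPP instance `(i₀,i₀,k)`
forces `t = t'`). Hence `(L + 1) · N² ≤ |H|`: exact two-leg tightness is impossible once `M ≥ 2`. -/
theorem succ_mul_sq_le_card {H : Type} [AddCommGroup H] [Fintype H] {L N M : ℕ}
    {A B C : Fin L → Finset H} (hS : IsSTPP A B C)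
    (hc : ∀ i, (A i).card = N ∧ (B i).card = M ∧ (C i).card = N) (hM : 2 ≤ M) (hL : 0 < L) :
    (L + 1) * N ^ 2 ≤ Fintype.card H := by
  classical
  have hBne : ∀ i, (B i).Nonempty := fun i => by
    rw [← Finset.card_pos]; have := (hc i).2.1; omega
  set i₀ : Fin L := ⟨0, hL⟩
  obtain ⟨t, ht, t', ht', htt'⟩ : ∃ t ∈ B i₀, ∃ t' ∈ B i₀, t ≠ t' := by
    rw [← Finset.one_lt_card]; have := (hc i₀).2.1; omega
  -- the pattern-(i,i,k) instance of IsSTPP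
  have inst : ∀ i k : Fin L, ∀ a ∈ A i, ∀ c ∈ C i, ∀ a' ∈ A k, ∀ c' ∈ C k, ∀ b ∈ B i, ∀ b' ∈ B i,
      (a - c) + (b' - b) = a' - c' → i = k ∧ a' = a ∧ b = b' ∧ c = c' := by
    intro i k a ha c hcC a' ha' c' hc' b hb b' hb' h
    have key := hS i i k a' ha' a ha b hb b' hb' c hcC c' hc' (by
      have e : (a - a') + (b' - b) + (c' - c) = (a - c) + (b' - b) - (a' - c') := by abel
      rw [e, h, sub_self])
    exact ⟨key.2.1, key.2.2.1, key.2.2.2.1, key.2.2.2.2⟩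
  -- two-leg difference sets
  set S : Fin L → Finset H := fun i => ((A i) ×ˢ (C i)).image fun p => p.1 - p.2 with hSdef
  have hmemS : ∀ i x, x ∈ S i ↔ ∃ a ∈ A i, ∃ c ∈ C i, a - c = x := by
    intro i x
    simp only [hSdef, Finset.mem_image, Finset.mem_product, Prod.exists]
    constructor
    · rintro ⟨a, c, ⟨ha, hcC⟩, rfl⟩; exact ⟨a, ha, c, hcC, rfl⟩
    · rintro ⟨a, ha, c, hcC, rfl⟩; exact ⟨a, c, ⟨ha, hcC⟩, rfl⟩
  have hcardS : ∀ i, (S i).card = N ^ 2 := by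
    intro i
    obtain ⟨b, hb⟩ := hBne i
    show (((A i) ×ˢ (C i)).image fun p : H × H => p.1 - p.2).card = N ^ 2
    rw [Finset.card_image_of_injOn, Finset.card_product, (hc i).1, (hc i).2.2, sq]
    rintro ⟨a, c⟩ hp ⟨a', c'⟩ hq hpq
    simp only [Finset.coe_product, Set.mem_prod, Finset.mem_coe] at hp hq
    simp only at hpq
    have key := inst i i a hp.1 c hp.2 a' hq.1 c' hq.2 b hb b hb
      (by rw [sub_self, add_zero]; exact hpq)
    exact Prod.ext key.2.1.symm key.2.2.2
  have hdisjS : ∀ i k, i ≠ k → Disjoint (S i) (S k) := by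
    intro i k hik
    rw [Finset.disjoint_left]
    intro x hxi hxk
    obtain ⟨a, ha, c, hcC, rfl⟩ := (hmemS i x).1 hxi
    obtain ⟨a', ha', c', hc', e⟩ := (hmemS k _).1 hxk
    obtain ⟨b, hb⟩ := hBne i
    exact hik (inst i k a ha c hcC a' ha' c' hc' b hb b hb (by rw [sub_self, add_zero, e])).1
  -- their union U has L N² elements
  set U : Finset H := Finset.univ.biUnion S with hU
  have hcardU : U.card = L * N ^ 2 := by
    rw [hU, Finset.card_biUnion (fun i _ k _ hik => hdisjS i k hik)]
    simp [hcardS]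
  -- the translate T of S i₀ by the nonzero B-difference t' - t
  set T : Finset H := (S i₀).image fun x => x + (t' - t) with hT
  have hcardT : T.card = N ^ 2 := by
    rw [hT, Finset.card_image_of_injective _ (add_left_injective _), hcardS]
  have hdisjUT : Disjoint U T := by
    rw [Finset.disjoint_left]
    intro x hxU hxT
    rw [hU, Finset.mem_biUnion] at hxU
    obtain ⟨k, -, hxk⟩ := hxU
    rw [hT, Finset.mem_image] at hxT
    obtain ⟨z, hz, rfl⟩ := hxT
    obtain ⟨a, ha, c, hcC, rfl⟩ := (hmemS i₀ z).1 hz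
    obtain ⟨a', ha', c', hc', e⟩ := (hmemS k _).1 hxk
    exact htt' (inst i₀ k a ha c hcC a' ha' c' hc' t ht t' ht' e.symm).2.2.1
  calc (L + 1) * N ^ 2 = U.card + T.card := by rw [hcardU, hcardT]; ring
    _ = (U ∪ T).card := (Finset.card_union_of_disjoint hdisjUT).symm
    _ ≤ Fintype.card H := Finset.card_le_univ _

/-- **No finite witness.** Consequently a single family (with `N ≥ 2`, `M ≥ 2`) always admits
SOME `η > 0` with `L · N^{2+η} < |H|` (Bernoulli: `N^η ≤ 1 + η (N-1)` with `η = 1/(2 L N)`), so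
`¬ RectangularThmB` can only be witnessed by an infinite SEQUENCE of families with
`log (|H| / (L N²)) / log N → 0`: the crux is genuinely asymptotic, finite search is pointless
(except as calibration of design families). -/
theorem no_finite_witness {H : Type} [AddCommGroup H] [Fintype H] {L N M : ℕ}
    {A B C : Fin L → Finset H} (hS : IsSTPP A B C)
    (hc : ∀ i, (A i).card = N ∧ (B i).card = M ∧ (C i).card = N) (hN : 2 ≤ N) (hM : 2 ≤ M) :
    ∃ η : ℝ, 0 < η ∧ (L : ℝ) * (N : ℝ) ^ (2 + η) < Fintype.card H := by
  rcases Nat.eq_zero_or_pos L with rfl | hL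
  · exact ⟨1, one_pos, by simp [Fintype.card_pos]⟩
  have hcard := succ_mul_sq_le_card hS hc hM hL
  have hN1 : (1 : ℝ) ≤ N := by exact_mod_cast le_trans (by norm_num) hN
  have hNpos : (0 : ℝ) < N := by linarith
  have hLpos : (0 : ℝ) < L := by exact_mod_cast hL
  have hL1 : (1 : ℝ) ≤ L := by exact_mod_cast hL
  refine ⟨1 / (2 * L * N), by positivity, ?_⟩
  set η : ℝ := 1 / (2 * L * N) with hηdef
  have hη0 : 0 ≤ η := by positivity
  have hLη : (L : ℝ) * η * (N - 1) < 1 := by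
    have e : (L : ℝ) * η * (N - 1) = (N - 1) / (2 * N) := by
      rw [hηdef]; field_simp
    rw [e, div_lt_one (by positivity)]
    linarith
  have hη1 : η ≤ 1 := by
    have hLN : (1 : ℝ) ≤ L * N := by nlinarith
    rw [hηdef, div_le_one (by positivity)]; linarith
  -- Bernoulli: N^η = (1 + (N-1))^η ≤ 1 + η (N - 1)
  have hB : (N : ℝ) ^ η ≤ 1 + η * (N - 1) := by
    have := rpow_one_add_le_one_add_mul_self (by linarith : (-1 : ℝ) ≤ N - 1) hη0 hη1
    simpa using this
  have hsplit : (N : ℝ) ^ (2 + η) = (N : ℝ) ^ 2 * (N : ℝ) ^ η := by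
    rw [Real.rpow_add hNpos, Real.rpow_two]
  rw [hsplit]
  have hcardR : ((L : ℝ) + 1) * (N : ℝ) ^ 2 ≤ Fintype.card H := by exact_mod_cast hcard
  have h1 : (L : ℝ) * ((N : ℝ) ^ 2 * (N : ℝ) ^ η) ≤ L * (N : ℝ) ^ 2 * (1 + η * (N - 1)) := by
    rw [← mul_assoc]; exact mul_le_mul_of_nonneg_left hB (by positivity)
  have hN2 : (0 : ℝ) < (N : ℝ) ^ 2 := by positivity
  have hmul := mul_lt_mul_of_pos_left hLη hN2
  have h2 : (L : ℝ) * (N : ℝ) ^ 2 * (1 + η * (N - 1)) < ((L : ℝ) + 1) * (N : ℝ) ^ 2 := by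
    calc (L : ℝ) * (N : ℝ) ^ 2 * (1 + η * (N - 1))
        = L * (N : ℝ) ^ 2 + (N : ℝ) ^ 2 * (L * η * (N - 1)) := by ring
      _ < L * (N : ℝ) ^ 2 + (N : ℝ) ^ 2 * 1 := by linarith
      _ = ((L : ℝ) + 1) * (N : ℝ) ^ 2 := by ring
  linarith


end Summit.MatrixMultiplication.MatrixMultiplication.Theorems.RectangularThmB.Negative
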